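import Literature.AnabelianGeometry.SemiGraphs.ArithLevelDataCptOfCosetTowerC
import Literature.AnabelianGeometry.SemiGraphs.ArithLevelDataCptThm54
import Literature.AnabelianGeometry.SemiGraphs.TemperedPiPresentationTowerInputs
import Literature.AnabelianGeometry.SemiGraphs.TemperedPiLevelKernelVerticial
import Literature.AnabelianGeometry.SemiGraphs.TemperedPiLevelsFiniteQuotient
import Literature.AnabelianGeometry.SemiGraphs.TemperedPiEdgeConjugatorsChart
import Literature.AnabelianGeometry.SemiGraphs.ArithTemperedGroupOfOuterAction
import Literature.AnabelianGeometry.SemiGraphs.TemperedPiLevelCosetIso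
import Literature.AnabelianGeometry.SemiGraphs.ArithTowerLevelStabilityJunction
import HarnessLib

/-!
# [SemiAnbd] Thm 5.4 (i)/(ii) AT `π₁^temp(𝒢) ⋊^out Π_A` FOR THE CHART OF AN ARBITRARY COFINAL GALOIS TOWER —
# the T54-B capstones, v3 (generic tower), and their form with CHARACTERISTIC finite levels (`hKst`/`hLst` gone)

Mochizuki, *Semi-graphs of anabelioids*, Publ. RIMS **42** (2006) 221–322, §5 Thm 5.4 (i)(ii), manuscript p. 66
(l. 50: "the proofs are entirely parallel to those of Theorem 3.7, Corollary 3.9"); Prop 3.6 (i)(ii) p. 38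
("`π₁^temp(G)` is independent, up to inner automorphism, of the choice of the cofinal system")
[cite: MochizukiSemiAnbd2006, Thm 5.4 (i), p. 66].

PROOF-ONLY file (abc-iut cell, layer L3, producer row T54-B = `plan/GAP-LEDGER.md` G-w4d053-1; seat
abc-iut-w4-d029 gen 4, the capstone lineage; recipe of abc-iut-L3-t9 2026-08-26T09:30:19Z «capstone v3 at the
characteristic tower»).  No definition, no new named fact, no producer restated.

The two T54-B CAPSTONES `arithMaximalCompactStatementI_outerAction_piPresentation` /
`arithMaximalCompactStatementII_outerAction_piPresentation` (ArithThm54iCapstoneOuterAction.lean /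
ArithThm54iiCapstoneOuterAction.lean) are stated for the FIXED enumeration `𝒢.galoisLevelData h36` of the Galois
levels and its chart `𝒢.temperedPiChart h36`.  Here the SAME composition
(`ArithLevelDataCpt.arithMaximalCompactStatement{I,II}_of (ArithLevelDataCpt.ofCosetTowerC …)`) is run for an
ARBITRARY Galois level data `D : GaloisLevelData 𝒢` of a connected countable `𝒢` whose levels are cofinal, split
themselves, are finite with nonempty fibres and connected (binders `h𝒢 hcof hcn hS hfin hne hconn` — the
binders of abc-iut-L3-t9's `GaloisLevelData.chart`, [SemiAnbd] Prop 3.6 (i)(ii) for ANY cofinal tower), over the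
chart `D.chart …` of THAT tower (`(D.chart …).G = D.temperedPi h𝒢` definitionally), every tree input bound BY
NAME in its generic form: abc-iut-L3-d4/w4-d085's `piPresentation_hT/hHK/hMK/hlift/hliftE/hfree`,
`finite_quotient_ker_piLevelAut`, `ker_projAut_anti`, `ker_piLevelAut_anti`, `ker_projAut_le_ker_piLevelAut`,
abc-iut-w4-d053's `_chart` transports (TemperedPiEdgeConjugatorsChart.lean p434016)
`PointSeq.range_decompHom_mem_verticialSubgroups_chart` / `piPresentation_M_mem_edgeLikeSubgroups_chart`, and
abc-iut-w4-d082/L3-d2's `outerAction_exact` (generic in the chart):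

* `arithMaximalCompactStatementI_outerAction_piPresentation_chart` — Thm 5.4 (i) at `D.chart`, residual
  binders VERBATIM those of the capstone (`hP`, `hKst`, `hLst`, `hKopen`, `noSwitchBase`, `hnobpNCpt`,
  `stabBranchPairAug`, `hest`, `hbot`);
* `arithMaximalCompactStatementII_outerAction_piPresentation_chart` — Thm 5.4 (ii) likewise (+ `hR`, `hVE`);
* `arithMaximalCompactStatement_outerAction_piPresentation_chart_of_charLevels` — **(i) ∧ (ii) when the finite
  levels are CHARACTERISTIC open cores**, `hker : ∀ n, ker π_n = charOpenCore (π₁^temp of the tower) (d n)`: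
  then the Φ-stability binders `hKst` AND `hLst` are DISCHARGED by abc-iut-L3-t9's E1 junction
  `GaloisLevelData.hKst_and_hLst_of_ker_piLevelAut_eq_charOpenCore` (ArithTowerLevelStabilityJunction.lean
  p432096) — the remaining binders (`hKopen`, `hnobpNCpt`, `stabBranchPairAug`) being stated at the DERIVED
  stability terms.  At abc-iut-L3-t9's tower `GaloisLevelData.ofOpenNormalSeq …` with
  `V k := charOpenCore (Aut (𝒢.fiberAt v₀)) (d k)` the hypothesis `hker` is its
  `ker_piLevelAut_ofOpenNormalSeq_eq_charOpenCore` (ArithTowerCharacteristicLevels.lean, p434994) — bound in the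
  sequel file once that module is built.

RESIDUAL INPUTS (explicit binders, owners as on the cell's T54 binder board): a topology on `E` with the two
properties used (`IsTopologicalGroup`, `hKopen`), `hP` (abc-iut-w4-d053's
`isArithCompatible_piPresentation_outerAction_of_branchPair_chart_of_finite`, TemperedPiEdgeConjugatorsChart.lean,
mod the design data `hV`/`hBR`), `noSwitchBase` (PRINT hypothesis of Thm 5.4's frame), `hnobpNCpt`
(abc-iut-w4-d083's chain), `stabBranchPairAug` = (AI4″) (abc-iut-w4-d059), Thm 5.4's own hypotheses `hest`,
`hbot`, and for (ii) Rmk 5.3.1's first sentence `hR` (abc-iut-w4-d040) and the rigidity `hVE` (T54-2), `E`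
Hausdorff.  Nothing beyond composition is proved here; typed ≠ proved for the residual inputs; this is Thm 5.4
for OUR tower decomposition; no side taken on [IUTchIII] Cor. 3.12.
-/

namespace Literature.AnabelianGeometry.SemiGraphs

namespace ProfiniteSemiGraph

open CategoryTheory Topology
open Literature.AnabelianGeometry.EtaleTheta
open scoped Pointwise

universe u

variable {𝒢 : ProfiniteSemiGraph.{u}} (D : GaloisLevelData 𝒢) (h𝒢 : 𝒢.IsCountable)
  (hcof : ∀ (T : CovObj 𝒢), T.IsTempered → ∀ p : T.Point,
    ∃ i : ℕ, ∀ j, i ≤ j → (D.S j).Splits (T.component p))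
  (hcn : 𝒢.graph.IsConnected) (hS : ∀ n, (D.S n).Splits (D.S n)) (hfin : ∀ n, (D.S n).IsFinite)
  (hne : ∀ n, (D.S n).HasNonemptyFibres)
  (hconn : ∀ (n : ℕ) (p q : (D.S n).Point), (D.S n).SameComponent p q)

/-- **[SemiAnbd] Thm 5.4 (i) at `π₁^temp(𝒢) ⋊^out Π_A` for the chart `D.chart` of an ARBITRARY cofinal Galois
tower `D`** — the T54-B capstone (i), v3, modulo exactly the capstone's residual inputs (composition by name; see
the module docstring for the owner of each residual). [cite: MochizukiSemiAnbd2006, Thm 5.4 (i), p. 66] -/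
theorem arithMaximalCompactStatementI_outerAction_piPresentation_chart
    (h37 : 𝒢.Thm37Hypotheses) (hG : 𝒢.graph.IsGraph) [Finite 𝒢.graph.Vertex] [Finite 𝒢.graph.Branch]
    {PA : Type u} [Group PA] [TopologicalSpace PA] [IsTopologicalGroup PA]
    (ρ' : PA →* TopOut (D.chart h𝒢 hcof hcn hS hfin hne).G) (baseAct : PA →* Aut 𝒢.graph)
    [TopologicalSpace (outerSemidirectProduct ρ')] [IsTopologicalGroup (outerSemidirectProduct ρ')]
    (T : ∀ w : 𝒢.graph.Vertex, D.PointSeq h𝒢 w) (R : SemiGraph.RefBranches 𝒢.graph)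
    (Rc : ChartRepresentatives (D.chart h𝒢 hcof hcn hS hfin hne))
    (hP : (D.piPresentation h𝒢 T R).IsArithCompatible (((contMulAut (D.chart h𝒢 hcof hcn hS hfin hne).G).subtype.comp (MonoidHom.fst (contMulAut (D.chart h𝒢 hcof hcn hS hfin hne).G) PA)).comp (outerSemidirectProduct ρ').subtype) (baseAct.comp (outerSemidirectProductSnd ρ')))
    (w₀ : 𝒢.graph.Vertex)
    (hKst : ∀ (n : ℕ) (e : outerSemidirectProduct ρ') (x : (D.chart h𝒢 hcof hcn hS hfin hne).G), x ∈ (D.projAut h𝒢 n).ker → (((contMulAut (D.chart h𝒢 hcof hcn hS hfin hne).G).subtype.comp (MonoidHom.fst (contMulAut (D.chart h𝒢 hcof hcn hS hfin hne).G) PA)).comp (outerSemidirectProduct ρ').subtype) e x ∈ (D.projAut h𝒢 n).ker)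
    (hLst : ∀ (n : ℕ) (e : outerSemidirectProduct ρ') (x : (D.chart h𝒢 hcof hcn hS hfin hne).G), x ∈ (D.piLevelAut h𝒢 hconn n).ker → (((contMulAut (D.chart h𝒢 hcof hcn hS hfin hne).G).subtype.comp (MonoidHom.fst (contMulAut (D.chart h𝒢 hcof hcn hS hfin hne).G) PA)).comp (outerSemidirectProduct ρ').subtype) e x ∈ (D.piLevelAut h𝒢 hconn n).ker)
    (hKopen : ∀ n, IsOpen (((D.piPresentation h𝒢 T R).arithAct hP (D.projAut h𝒢 n).ker (hKst n)).ker : Set (outerSemidirectProduct ρ')))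
    (noSwitchBase : NoBranchSwitching 𝒢.graph.edgeOf
      (fun (a : PA) (b : 𝒢.graph.Branch) => (baseAct a).hom.branchMap b))
    (hnobpNCpt : ∀ (C : Subgroup (D.chart h𝒢 hcof hcn hS hfin hne).G), IsCompact (C : Set (D.chart h𝒢 hcof hcn hS hfin hne).G) →
      ∀ (j₀ : ℕ) (w : ∀ i : {i : ℕ // j₀ ≤ i}, ((D.piPresentation h𝒢 T R).cosetGraph (D.piLevelAut h𝒢 hconn i.1).ker).Vertex)
      (β β' : ∀ i : {i : ℕ // j₀ ≤ i}, ((D.piPresentation h𝒢 T R).cosetGraph (D.piLevelAut h𝒢 hconn i.1).ker).Branch),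
      (∀ i, β i ≠ β' i ∧ ((D.piPresentation h𝒢 T R).cosetGraph (D.piLevelAut h𝒢 hconn i.1).ker).abuts (β i) = some (w i) ∧
        ((D.piPresentation h𝒢 T R).cosetGraph (D.piLevelAut h𝒢 hconn i.1).ker).abuts (β' i) = some (w i)) →
      (∀ ⦃i i' : {i : ℕ // j₀ ≤ i}⦄ (h : i.1 ≤ i'.1),
        ((D.piPresentation h𝒢 T R).cosetGraphTrans (D.ker_piLevelAut_anti h𝒢 hconn h)).vertexMap (w i') = w i ∧
        ((D.piPresentation h𝒢 T R).cosetGraphTrans (D.ker_piLevelAut_anti h𝒢 hconn h)).branchMap (β i') = β i ∧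
          ((D.piPresentation h𝒢 T R).cosetGraphTrans (D.ker_piLevelAut_anti h𝒢 hconn h)).branchMap (β' i') = β' i) →
      (∀ (i : {i : ℕ // j₀ ≤ i}) (γ : C),
        ((D.piPresentation h𝒢 T R).arithAct hP (D.piLevelAut h𝒢 hconn i.1).ker (hLst i.1) ((toOuterSemidirectProduct ρ') γ)).hom.vertexMap (w i) = w i ∧
        ((D.piPresentation h𝒢 T R).arithAct hP (D.piLevelAut h𝒢 hconn i.1).ker (hLst i.1) ((toOuterSemidirectProduct ρ') γ)).hom.branchMap (β i) = β i ∧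
          ((D.piPresentation h𝒢 T R).arithAct hP (D.piLevelAut h𝒢 hconn i.1).ker (hLst i.1) ((toOuterSemidirectProduct ρ') γ)).hom.branchMap (β' i) = β' i) → C = ⊥)
    (stabBranchPairAug : ∀ (C : Subgroup (outerSemidirectProduct ρ')),
      IsCompact (C : Set (outerSemidirectProduct ρ')) →
      ∀ (j₀ : ℕ) (w : ∀ i : {i : ℕ // j₀ ≤ i}, ((D.piPresentation h𝒢 T R).cosetGraph (D.piLevelAut h𝒢 hconn i.1).ker).Vertex)
      (β β' : ∀ i : {i : ℕ // j₀ ≤ i}, ((D.piPresentation h𝒢 T R).cosetGraph (D.piLevelAut h𝒢 hconn i.1).ker).Branch),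
      (∀ i, β i ≠ β' i ∧ ((D.piPresentation h𝒢 T R).cosetGraph (D.piLevelAut h𝒢 hconn i.1).ker).abuts (β i) = some (w i) ∧
        ((D.piPresentation h𝒢 T R).cosetGraph (D.piLevelAut h𝒢 hconn i.1).ker).abuts (β' i) = some (w i)) →
      (∀ ⦃i i' : {i : ℕ // j₀ ≤ i}⦄ (h : i.1 ≤ i'.1),
        ((D.piPresentation h𝒢 T R).cosetGraphTrans (D.ker_piLevelAut_anti h𝒢 hconn h)).vertexMap (w i') = w i ∧
        ((D.piPresentation h𝒢 T R).cosetGraphTrans (D.ker_piLevelAut_anti h𝒢 hconn h)).branchMap (β i') = β i ∧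
          ((D.piPresentation h𝒢 T R).cosetGraphTrans (D.ker_piLevelAut_anti h𝒢 hconn h)).branchMap (β' i') = β' i) →
      (∀ (i : {i : ℕ // j₀ ≤ i}) (g : outerSemidirectProduct ρ'), g ∈ C →
        ((D.piPresentation h𝒢 T R).arithAct hP (D.piLevelAut h𝒢 hconn i.1).ker (hLst i.1) g).hom.vertexMap (w i) = w i ∧
        ((D.piPresentation h𝒢 T R).arithAct hP (D.piLevelAut h𝒢 hconn i.1).ker (hLst i.1) g).hom.branchMap (β i) = β i ∧
          ((D.piPresentation h𝒢 T R).arithAct hP (D.piLevelAut h𝒢 hconn i.1).ker (hLst i.1) g).hom.branchMap (β' i) = β' i) →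
      ∃ (v : 𝒢.graph.Vertex) (b b' : 𝒢.graph.Branch) (a : PA) (h : outerSemidirectProduct ρ'),
        (decompositionDataOfChart Rc (toOuterSemidirectProduct ρ')).abut b = some v ∧ (decompositionDataOfChart Rc (toOuterSemidirectProduct ρ')).abut b' = some v ∧
        h ∈ (decompositionDataOfChart Rc (toOuterSemidirectProduct ρ')).vertGp v ∧ (b' ≠ b ∨ h ∉ (decompositionDataOfChart Rc (toOuterSemidirectProduct ρ')).brGp b) ∧
        C.map (outerSemidirectProductSnd ρ') ≤ conjSubgroup a (((decompositionDataOfChart Rc (toOuterSemidirectProduct ρ')).brGp b ⊓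
          conjSubgroup h ((decompositionDataOfChart Rc (toOuterSemidirectProduct ρ')).brGp b')).map (outerSemidirectProductSnd ρ')))
    (hest : IsTotallyArithEstranged (decompositionDataOfChart Rc (toOuterSemidirectProduct ρ')) (outerSemidirectProductSnd ρ')) (hbot : ¬ IsArithAmple (outerSemidirectProductSnd ρ') ⊥) :
    ArithMaximalCompactStatementI (decompositionDataOfChart Rc (toOuterSemidirectProduct ρ')) (outerSemidirectProductSnd ρ') := by
  -- exactness of `1 → π₁^temp → E → Π_A → 1` (temp-slimness)
  obtain ⟨hι, hex, -⟩ := outerAction_exact (D.chart h𝒢 hcof hcn hS hfin hne) ρ' h37.toProp36Hypotheses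
  have hnorm : ((toOuterSemidirectProduct ρ').range).Normal := by rw [hex]; infer_instance
  have hιΦ : ∀ g : (D.chart h𝒢 hcof hcn hS hfin hne).G, (((contMulAut (D.chart h𝒢 hcof hcn hS hfin hne).G).subtype.comp (MonoidHom.fst (contMulAut (D.chart h𝒢 hcof hcn hS hfin hne).G) PA)).comp (outerSemidirectProduct ρ').subtype) ((toOuterSemidirectProduct ρ') g) = MulAut.conj g := fun _ => rfl
  have hισ : ∀ g : (D.chart h𝒢 hcof hcn hS hfin hne).G, (baseAct.comp (outerSemidirectProductSnd ρ')) ((toOuterSemidirectProduct ρ') g) = 1 := fun g => by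
    have hg : (toOuterSemidirectProduct ρ') g ∈ (outerSemidirectProductSnd ρ').ker := hex ▸ ⟨g, rfl⟩
    rw [MonoidHom.comp_apply, (MonoidHom.mem_ker).mp hg, map_one]
  have hPH : ∀ w, (D.piPresentation h𝒢 T R).H w ∈ verticialSubgroups (D.chart h𝒢 hcof hcn hS hfin hne) w := fun w => by
    rw [D.piPresentation_H h𝒢 T R]
    exact (T w).range_decompHom_mem_verticialSubgroups_chart hcof hcn hS hfin hne
  let Lc := @ArithLevelDataCpt.ofCosetTowerC 𝒢 (D.chart h𝒢 hcof hcn hS hfin hne) h37 hG _ _ Rc (outerSemidirectProduct ρ') _ _ PA _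
    (toOuterSemidirectProduct ρ') hι hnorm (outerSemidirectProductSnd ρ') baseAct (D.piPresentation h𝒢 T R) _ hP hιΦ hισ hPH
    (fun ε => piPresentation_M_mem_edgeLikeSubgroups_chart D h𝒢 hcof hcn hS hfin hne T R ε) w₀
    (fun n => (D.projAut h𝒢 n).ker) (fun _ => MonoidHom.normal_ker _) (D.ker_projAut_anti h𝒢)
    hKst (D.piPresentation_hT h𝒢 T R) hKopen noSwitchBase
    (D.piPresentation_hHK h𝒢 T R) (D.piPresentation_hMK h𝒢 T R)
    (D.piPresentation_hlift h𝒢 T R) (D.piPresentation_hliftE h𝒢 T R)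
    (fun n => (D.piLevelAut h𝒢 hconn n).ker) (fun _ => MonoidHom.normal_ker _)
    (fun j => D.finite_quotient_ker_piLevelAut h𝒢 hconn hfin j)
    (D.ker_piLevelAut_anti h𝒢 hconn) hLst
    (fun n => D.ker_projAut_le_ker_piLevelAut h𝒢 hconn n)
    (D.piPresentation_hfree h𝒢 hconn T R) hnobpNCpt stabBranchPairAug
  exact Lc.arithMaximalCompactStatementI_of (abut_isSome_of_isGraph Rc (toOuterSemidirectProduct ρ') hG) hest hbot

/-- **[SemiAnbd] Thm 5.4 (ii) at `π₁^temp(𝒢) ⋊^out Π_A` for the chart `D.chart` of an ARBITRARY cofinal Galois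
tower `D`** — the T54-B capstone (ii), v3, modulo the residual inputs of part (i) and, as explicit binders,
Rmk 5.3.1's first sentence `hR` and the rigidity `hVE`; `E` Hausdorff.  Composition by name:
`ArithLevelDataCpt.arithMaximalCompactStatementII_of` at `ArithLevelDataCpt.ofCosetTowerC`.
[cite: MochizukiSemiAnbd2006, Thm 5.4 (ii), p. 66] -/
theorem arithMaximalCompactStatementII_outerAction_piPresentation_chart
    (h37 : 𝒢.Thm37Hypotheses) (hG : 𝒢.graph.IsGraph) [Finite 𝒢.graph.Vertex] [Finite 𝒢.graph.Branch]
    {PA : Type u} [Group PA] [TopologicalSpace PA] [IsTopologicalGroup PA]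
    (ρ' : PA →* TopOut (D.chart h𝒢 hcof hcn hS hfin hne).G) (baseAct : PA →* Aut 𝒢.graph)
    [TopologicalSpace (outerSemidirectProduct ρ')] [IsTopologicalGroup (outerSemidirectProduct ρ')]
    [T2Space (outerSemidirectProduct ρ')]
    (T : ∀ w : 𝒢.graph.Vertex, D.PointSeq h𝒢 w) (R : SemiGraph.RefBranches 𝒢.graph)
    (Rc : ChartRepresentatives (D.chart h𝒢 hcof hcn hS hfin hne))
    (hP : (D.piPresentation h𝒢 T R).IsArithCompatible (((contMulAut (D.chart h𝒢 hcof hcn hS hfin hne).G).subtype.comp (MonoidHom.fst (contMulAut (D.chart h𝒢 hcof hcn hS hfin hne).G) PA)).comp (outerSemidirectProduct ρ').subtype) (baseAct.comp (outerSemidirectProductSnd ρ')))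
    (w₀ : 𝒢.graph.Vertex)
    (hKst : ∀ (n : ℕ) (e : outerSemidirectProduct ρ') (x : (D.chart h𝒢 hcof hcn hS hfin hne).G), x ∈ (D.projAut h𝒢 n).ker → (((contMulAut (D.chart h𝒢 hcof hcn hS hfin hne).G).subtype.comp (MonoidHom.fst (contMulAut (D.chart h𝒢 hcof hcn hS hfin hne).G) PA)).comp (outerSemidirectProduct ρ').subtype) e x ∈ (D.projAut h𝒢 n).ker)
    (hLst : ∀ (n : ℕ) (e : outerSemidirectProduct ρ') (x : (D.chart h𝒢 hcof hcn hS hfin hne).G), x ∈ (D.piLevelAut h𝒢 hconn n).ker → (((contMulAut (D.chart h𝒢 hcof hcn hS hfin hne).G).subtype.comp (MonoidHom.fst (contMulAut (D.chart h𝒢 hcof hcn hS hfin hne).G) PA)).comp (outerSemidirectProduct ρ').subtype) e x ∈ (D.piLevelAut h𝒢 hconn n).ker)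
    (hKopen : ∀ n, IsOpen (((D.piPresentation h𝒢 T R).arithAct hP (D.projAut h𝒢 n).ker (hKst n)).ker : Set (outerSemidirectProduct ρ')))
    (noSwitchBase : NoBranchSwitching 𝒢.graph.edgeOf
      (fun (a : PA) (b : 𝒢.graph.Branch) => (baseAct a).hom.branchMap b))
    (hnobpNCpt : ∀ (C : Subgroup (D.chart h𝒢 hcof hcn hS hfin hne).G), IsCompact (C : Set (D.chart h𝒢 hcof hcn hS hfin hne).G) →
      ∀ (j₀ : ℕ) (w : ∀ i : {i : ℕ // j₀ ≤ i}, ((D.piPresentation h𝒢 T R).cosetGraph (D.piLevelAut h𝒢 hconn i.1).ker).Vertex)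
      (β β' : ∀ i : {i : ℕ // j₀ ≤ i}, ((D.piPresentation h𝒢 T R).cosetGraph (D.piLevelAut h𝒢 hconn i.1).ker).Branch),
      (∀ i, β i ≠ β' i ∧ ((D.piPresentation h𝒢 T R).cosetGraph (D.piLevelAut h𝒢 hconn i.1).ker).abuts (β i) = some (w i) ∧
        ((D.piPresentation h𝒢 T R).cosetGraph (D.piLevelAut h𝒢 hconn i.1).ker).abuts (β' i) = some (w i)) →
      (∀ ⦃i i' : {i : ℕ // j₀ ≤ i}⦄ (h : i.1 ≤ i'.1),
        ((D.piPresentation h𝒢 T R).cosetGraphTrans (D.ker_piLevelAut_anti h𝒢 hconn h)).vertexMap (w i') = w i ∧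
        ((D.piPresentation h𝒢 T R).cosetGraphTrans (D.ker_piLevelAut_anti h𝒢 hconn h)).branchMap (β i') = β i ∧
          ((D.piPresentation h𝒢 T R).cosetGraphTrans (D.ker_piLevelAut_anti h𝒢 hconn h)).branchMap (β' i') = β' i) →
      (∀ (i : {i : ℕ // j₀ ≤ i}) (γ : C),
        ((D.piPresentation h𝒢 T R).arithAct hP (D.piLevelAut h𝒢 hconn i.1).ker (hLst i.1) ((toOuterSemidirectProduct ρ') γ)).hom.vertexMap (w i) = w i ∧
        ((D.piPresentation h𝒢 T R).arithAct hP (D.piLevelAut h𝒢 hconn i.1).ker (hLst i.1) ((toOuterSemidirectProduct ρ') γ)).hom.branchMap (β i) = β i ∧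
          ((D.piPresentation h𝒢 T R).arithAct hP (D.piLevelAut h𝒢 hconn i.1).ker (hLst i.1) ((toOuterSemidirectProduct ρ') γ)).hom.branchMap (β' i) = β' i) → C = ⊥)
    (stabBranchPairAug : ∀ (C : Subgroup (outerSemidirectProduct ρ')),
      IsCompact (C : Set (outerSemidirectProduct ρ')) →
      ∀ (j₀ : ℕ) (w : ∀ i : {i : ℕ // j₀ ≤ i}, ((D.piPresentation h𝒢 T R).cosetGraph (D.piLevelAut h𝒢 hconn i.1).ker).Vertex)
      (β β' : ∀ i : {i : ℕ // j₀ ≤ i}, ((D.piPresentation h𝒢 T R).cosetGraph (D.piLevelAut h𝒢 hconn i.1).ker).Branch),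
      (∀ i, β i ≠ β' i ∧ ((D.piPresentation h𝒢 T R).cosetGraph (D.piLevelAut h𝒢 hconn i.1).ker).abuts (β i) = some (w i) ∧
        ((D.piPresentation h𝒢 T R).cosetGraph (D.piLevelAut h𝒢 hconn i.1).ker).abuts (β' i) = some (w i)) →
      (∀ ⦃i i' : {i : ℕ // j₀ ≤ i}⦄ (h : i.1 ≤ i'.1),
        ((D.piPresentation h𝒢 T R).cosetGraphTrans (D.ker_piLevelAut_anti h𝒢 hconn h)).vertexMap (w i') = w i ∧
        ((D.piPresentation h𝒢 T R).cosetGraphTrans (D.ker_piLevelAut_anti h𝒢 hconn h)).branchMap (β i') = β i ∧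
          ((D.piPresentation h𝒢 T R).cosetGraphTrans (D.ker_piLevelAut_anti h𝒢 hconn h)).branchMap (β' i') = β' i) →
      (∀ (i : {i : ℕ // j₀ ≤ i}) (g : outerSemidirectProduct ρ'), g ∈ C →
        ((D.piPresentation h𝒢 T R).arithAct hP (D.piLevelAut h𝒢 hconn i.1).ker (hLst i.1) g).hom.vertexMap (w i) = w i ∧
        ((D.piPresentation h𝒢 T R).arithAct hP (D.piLevelAut h𝒢 hconn i.1).ker (hLst i.1) g).hom.branchMap (β i) = β i ∧
          ((D.piPresentation h𝒢 T R).arithAct hP (D.piLevelAut h𝒢 hconn i.1).ker (hLst i.1) g).hom.branchMap (β' i) = β' i) →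
      ∃ (v : 𝒢.graph.Vertex) (b b' : 𝒢.graph.Branch) (a : PA) (h : outerSemidirectProduct ρ'),
        (decompositionDataOfChart Rc (toOuterSemidirectProduct ρ')).abut b = some v ∧ (decompositionDataOfChart Rc (toOuterSemidirectProduct ρ')).abut b' = some v ∧
        h ∈ (decompositionDataOfChart Rc (toOuterSemidirectProduct ρ')).vertGp v ∧ (b' ≠ b ∨ h ∉ (decompositionDataOfChart Rc (toOuterSemidirectProduct ρ')).brGp b) ∧
        C.map (outerSemidirectProductSnd ρ') ≤ conjSubgroup a (((decompositionDataOfChart Rc (toOuterSemidirectProduct ρ')).brGp b ⊓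
          conjSubgroup h ((decompositionDataOfChart Rc (toOuterSemidirectProduct ρ')).brGp b')).map (outerSemidirectProductSnd ρ')))
    (hest : IsTotallyArithEstranged (decompositionDataOfChart Rc (toOuterSemidirectProduct ρ')) (outerSemidirectProductSnd ρ')) (hbot : ¬ IsArithAmple (outerSemidirectProductSnd ρ') ⊥)
    (hR : VerticialEdgeLikeCompactAmpleStatement (decompositionDataOfChart Rc (toOuterSemidirectProduct ρ'))
      (outerSemidirectProductSnd ρ'))
    (hVE : ∀ K : Subgroup (outerSemidirectProduct ρ'),
      IsVerticial (decompositionDataOfChart Rc (toOuterSemidirectProduct ρ')) K →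
        ¬ IsEdgeLike (decompositionDataOfChart Rc (toOuterSemidirectProduct ρ')) K) :
    ArithMaximalCompactStatementII (decompositionDataOfChart Rc (toOuterSemidirectProduct ρ')) (outerSemidirectProductSnd ρ') := by
  -- exactness of `1 → π₁^temp → E → Π_A → 1` (temp-slimness)
  obtain ⟨hι, hex, -⟩ := outerAction_exact (D.chart h𝒢 hcof hcn hS hfin hne) ρ' h37.toProp36Hypotheses
  have hnorm : ((toOuterSemidirectProduct ρ').range).Normal := by rw [hex]; infer_instance
  have hιΦ : ∀ g : (D.chart h𝒢 hcof hcn hS hfin hne).G, (((contMulAut (D.chart h𝒢 hcof hcn hS hfin hne).G).subtype.comp (MonoidHom.fst (contMulAut (D.chart h𝒢 hcof hcn hS hfin hne).G) PA)).comp (outerSemidirectProduct ρ').subtype) ((toOuterSemidirectProduct ρ') g) = MulAut.conj g := fun _ => rfl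
  have hισ : ∀ g : (D.chart h𝒢 hcof hcn hS hfin hne).G, (baseAct.comp (outerSemidirectProductSnd ρ')) ((toOuterSemidirectProduct ρ') g) = 1 := fun g => by
    have hg : (toOuterSemidirectProduct ρ') g ∈ (outerSemidirectProductSnd ρ').ker := hex ▸ ⟨g, rfl⟩
    rw [MonoidHom.comp_apply, (MonoidHom.mem_ker).mp hg, map_one]
  have hPH : ∀ w, (D.piPresentation h𝒢 T R).H w ∈ verticialSubgroups (D.chart h𝒢 hcof hcn hS hfin hne) w := fun w => by
    rw [D.piPresentation_H h𝒢 T R]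
    exact (T w).range_decompHom_mem_verticialSubgroups_chart hcof hcn hS hfin hne
  let Lc := @ArithLevelDataCpt.ofCosetTowerC 𝒢 (D.chart h𝒢 hcof hcn hS hfin hne) h37 hG _ _ Rc (outerSemidirectProduct ρ') _ _ PA _
    (toOuterSemidirectProduct ρ') hι hnorm (outerSemidirectProductSnd ρ') baseAct (D.piPresentation h𝒢 T R) _ hP hιΦ hισ hPH
    (fun ε => piPresentation_M_mem_edgeLikeSubgroups_chart D h𝒢 hcof hcn hS hfin hne T R ε) w₀
    (fun n => (D.projAut h𝒢 n).ker) (fun _ => MonoidHom.normal_ker _) (D.ker_projAut_anti h𝒢)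
    hKst (D.piPresentation_hT h𝒢 T R) hKopen noSwitchBase
    (D.piPresentation_hHK h𝒢 T R) (D.piPresentation_hMK h𝒢 T R)
    (D.piPresentation_hlift h𝒢 T R) (D.piPresentation_hliftE h𝒢 T R)
    (fun n => (D.piLevelAut h𝒢 hconn n).ker) (fun _ => MonoidHom.normal_ker _)
    (fun j => D.finite_quotient_ker_piLevelAut h𝒢 hconn hfin j)
    (D.ker_piLevelAut_anti h𝒢 hconn) hLst
    (fun n => D.ker_projAut_le_ker_piLevelAut h𝒢 hconn n)
    (D.piPresentation_hfree h𝒢 hconn T R) hnobpNCpt stabBranchPairAug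
  exact Lc.arithMaximalCompactStatementII_of (abut_isSome_of_isGraph Rc (toOuterSemidirectProduct ρ') hG) hest hbot hR hVE

/-- **[SemiAnbd] Thm 5.4 (i) ∧ (ii) at `π₁^temp(𝒢) ⋊^out Π_A` for the chart of a cofinal Galois tower `D` WITH
CHARACTERISTIC FINITE LEVELS — the capstones with the Φ-stability binders `hKst`/`hLst` DISCHARGED.**  If every
finite-level kernel `ker π_n` of the tower is the characteristic open core `charOpenCore (π₁^temp) (d n)` (`hker`;
abc-iut-L3-t9's `ker_piLevelAut_ofOpenNormalSeq_eq_charOpenCore` supplies it for the tower of characteristic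
cores), then both stability inputs of the capstones are abc-iut-L3-t9's theorem
`GaloisLevelData.hKst_and_hLst_of_ker_piLevelAut_eq_charOpenCore` (E1 junction), and Thm 5.4 (i) ∧ (ii) hold for
the produced decomposition data modulo the remaining named inputs only (`hKopen`, `hnobpNCpt`, `stabBranchPairAug`
stated at the derived stability terms). [cite: MochizukiSemiAnbd2006, Thm 5.4 (i), p. 66] -/
theorem arithMaximalCompactStatement_outerAction_piPresentation_chart_of_charLevels
    (h37 : 𝒢.Thm37Hypotheses) (hG : 𝒢.graph.IsGraph) [Finite 𝒢.graph.Vertex] [Finite 𝒢.graph.Branch]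
    {PA : Type u} [Group PA] [TopologicalSpace PA] [IsTopologicalGroup PA]
    (ρ' : PA →* TopOut (D.chart h𝒢 hcof hcn hS hfin hne).G) (baseAct : PA →* Aut 𝒢.graph)
    [TopologicalSpace (outerSemidirectProduct ρ')] [IsTopologicalGroup (outerSemidirectProduct ρ')]
    [T2Space (outerSemidirectProduct ρ')]
    (T : ∀ w : 𝒢.graph.Vertex, D.PointSeq h𝒢 w) (R : SemiGraph.RefBranches 𝒢.graph)
    (Rc : ChartRepresentatives (D.chart h𝒢 hcof hcn hS hfin hne))
    (hP : (D.piPresentation h𝒢 T R).IsArithCompatible (((contMulAut (D.chart h𝒢 hcof hcn hS hfin hne).G).subtype.comp (MonoidHom.fst (contMulAut (D.chart h𝒢 hcof hcn hS hfin hne).G) PA)).comp (outerSemidirectProduct ρ').subtype) (baseAct.comp (outerSemidirectProductSnd ρ')))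
    (w₀ : 𝒢.graph.Vertex)
    -- CHARACTERISTIC finite levels (abc-iut-L3-t9 E1): `ker π_n` is the characteristic open core of level `d n`
    (d : ℕ → ℕ) (hker : ∀ n, (D.piLevelAut h𝒢 hconn n).ker = charOpenCore (D.temperedPi h𝒢) (d n))
    (hKopen : ∀ n, IsOpen (((D.piPresentation h𝒢 T R).arithAct hP (D.projAut h𝒢 n).ker ((D.hKst_and_hLst_of_ker_piLevelAut_eq_charOpenCore h𝒢 hconn T R ρ' hP d hker).1 n)).ker : Set (outerSemidirectProduct ρ')))
    (noSwitchBase : NoBranchSwitching 𝒢.graph.edgeOf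
      (fun (a : PA) (b : 𝒢.graph.Branch) => (baseAct a).hom.branchMap b))
    (hnobpNCpt : ∀ (C : Subgroup (D.chart h𝒢 hcof hcn hS hfin hne).G), IsCompact (C : Set (D.chart h𝒢 hcof hcn hS hfin hne).G) →
      ∀ (j₀ : ℕ) (w : ∀ i : {i : ℕ // j₀ ≤ i}, ((D.piPresentation h𝒢 T R).cosetGraph (D.piLevelAut h𝒢 hconn i.1).ker).Vertex)
      (β β' : ∀ i : {i : ℕ // j₀ ≤ i}, ((D.piPresentation h𝒢 T R).cosetGraph (D.piLevelAut h𝒢 hconn i.1).ker).Branch),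
      (∀ i, β i ≠ β' i ∧ ((D.piPresentation h𝒢 T R).cosetGraph (D.piLevelAut h𝒢 hconn i.1).ker).abuts (β i) = some (w i) ∧
        ((D.piPresentation h𝒢 T R).cosetGraph (D.piLevelAut h𝒢 hconn i.1).ker).abuts (β' i) = some (w i)) →
      (∀ ⦃i i' : {i : ℕ // j₀ ≤ i}⦄ (h : i.1 ≤ i'.1),
        ((D.piPresentation h𝒢 T R).cosetGraphTrans (D.ker_piLevelAut_anti h𝒢 hconn h)).vertexMap (w i') = w i ∧
        ((D.piPresentation h𝒢 T R).cosetGraphTrans (D.ker_piLevelAut_anti h𝒢 hconn h)).branchMap (β i') = β i ∧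
          ((D.piPresentation h𝒢 T R).cosetGraphTrans (D.ker_piLevelAut_anti h𝒢 hconn h)).branchMap (β' i') = β' i) →
      (∀ (i : {i : ℕ // j₀ ≤ i}) (γ : C),
        ((D.piPresentation h𝒢 T R).arithAct hP (D.piLevelAut h𝒢 hconn i.1).ker ((D.hKst_and_hLst_of_ker_piLevelAut_eq_charOpenCore h𝒢 hconn T R ρ' hP d hker).2 i.1) ((toOuterSemidirectProduct ρ') γ)).hom.vertexMap (w i) = w i ∧
        ((D.piPresentation h𝒢 T R).arithAct hP (D.piLevelAut h𝒢 hconn i.1).ker ((D.hKst_and_hLst_of_ker_piLevelAut_eq_charOpenCore h𝒢 hconn T R ρ' hP d hker).2 i.1) ((toOuterSemidirectProduct ρ') γ)).hom.branchMap (β i) = β i ∧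
          ((D.piPresentation h𝒢 T R).arithAct hP (D.piLevelAut h𝒢 hconn i.1).ker ((D.hKst_and_hLst_of_ker_piLevelAut_eq_charOpenCore h𝒢 hconn T R ρ' hP d hker).2 i.1) ((toOuterSemidirectProduct ρ') γ)).hom.branchMap (β' i) = β' i) → C = ⊥)
    (stabBranchPairAug : ∀ (C : Subgroup (outerSemidirectProduct ρ')),
      IsCompact (C : Set (outerSemidirectProduct ρ')) →
      ∀ (j₀ : ℕ) (w : ∀ i : {i : ℕ // j₀ ≤ i}, ((D.piPresentation h𝒢 T R).cosetGraph (D.piLevelAut h𝒢 hconn i.1).ker).Vertex)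
      (β β' : ∀ i : {i : ℕ // j₀ ≤ i}, ((D.piPresentation h𝒢 T R).cosetGraph (D.piLevelAut h𝒢 hconn i.1).ker).Branch),
      (∀ i, β i ≠ β' i ∧ ((D.piPresentation h𝒢 T R).cosetGraph (D.piLevelAut h𝒢 hconn i.1).ker).abuts (β i) = some (w i) ∧
        ((D.piPresentation h𝒢 T R).cosetGraph (D.piLevelAut h𝒢 hconn i.1).ker).abuts (β' i) = some (w i)) →
      (∀ ⦃i i' : {i : ℕ // j₀ ≤ i}⦄ (h : i.1 ≤ i'.1),
        ((D.piPresentation h𝒢 T R).cosetGraphTrans (D.ker_piLevelAut_anti h𝒢 hconn h)).vertexMap (w i') = w i ∧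
        ((D.piPresentation h𝒢 T R).cosetGraphTrans (D.ker_piLevelAut_anti h𝒢 hconn h)).branchMap (β i') = β i ∧
          ((D.piPresentation h𝒢 T R).cosetGraphTrans (D.ker_piLevelAut_anti h𝒢 hconn h)).branchMap (β' i') = β' i) →
      (∀ (i : {i : ℕ // j₀ ≤ i}) (g : outerSemidirectProduct ρ'), g ∈ C →
        ((D.piPresentation h𝒢 T R).arithAct hP (D.piLevelAut h𝒢 hconn i.1).ker ((D.hKst_and_hLst_of_ker_piLevelAut_eq_charOpenCore h𝒢 hconn T R ρ' hP d hker).2 i.1) g).hom.vertexMap (w i) = w i ∧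
        ((D.piPresentation h𝒢 T R).arithAct hP (D.piLevelAut h𝒢 hconn i.1).ker ((D.hKst_and_hLst_of_ker_piLevelAut_eq_charOpenCore h𝒢 hconn T R ρ' hP d hker).2 i.1) g).hom.branchMap (β i) = β i ∧
          ((D.piPresentation h𝒢 T R).arithAct hP (D.piLevelAut h𝒢 hconn i.1).ker ((D.hKst_and_hLst_of_ker_piLevelAut_eq_charOpenCore h𝒢 hconn T R ρ' hP d hker).2 i.1) g).hom.branchMap (β' i) = β' i) →
      ∃ (v : 𝒢.graph.Vertex) (b b' : 𝒢.graph.Branch) (a : PA) (h : outerSemidirectProduct ρ'),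
        (decompositionDataOfChart Rc (toOuterSemidirectProduct ρ')).abut b = some v ∧ (decompositionDataOfChart Rc (toOuterSemidirectProduct ρ')).abut b' = some v ∧
        h ∈ (decompositionDataOfChart Rc (toOuterSemidirectProduct ρ')).vertGp v ∧ (b' ≠ b ∨ h ∉ (decompositionDataOfChart Rc (toOuterSemidirectProduct ρ')).brGp b) ∧
        C.map (outerSemidirectProductSnd ρ') ≤ conjSubgroup a (((decompositionDataOfChart Rc (toOuterSemidirectProduct ρ')).brGp b ⊓
          conjSubgroup h ((decompositionDataOfChart Rc (toOuterSemidirectProduct ρ')).brGp b')).map (outerSemidirectProductSnd ρ')))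
    (hest : IsTotallyArithEstranged (decompositionDataOfChart Rc (toOuterSemidirectProduct ρ')) (outerSemidirectProductSnd ρ')) (hbot : ¬ IsArithAmple (outerSemidirectProductSnd ρ') ⊥)
    (hR : VerticialEdgeLikeCompactAmpleStatement (decompositionDataOfChart Rc (toOuterSemidirectProduct ρ'))
      (outerSemidirectProductSnd ρ'))
    (hVE : ∀ K : Subgroup (outerSemidirectProduct ρ'),
      IsVerticial (decompositionDataOfChart Rc (toOuterSemidirectProduct ρ')) K →
        ¬ IsEdgeLike (decompositionDataOfChart Rc (toOuterSemidirectProduct ρ')) K) :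
    ArithMaximalCompactStatementI (decompositionDataOfChart Rc (toOuterSemidirectProduct ρ')) (outerSemidirectProductSnd ρ') ∧
      ArithMaximalCompactStatementII (decompositionDataOfChart Rc (toOuterSemidirectProduct ρ')) (outerSemidirectProductSnd ρ') :=
  ⟨arithMaximalCompactStatementI_outerAction_piPresentation_chart D h𝒢 hcof hcn hS hfin hne hconn h37 hG ρ' baseAct T R Rc hP w₀
      (D.hKst_and_hLst_of_ker_piLevelAut_eq_charOpenCore h𝒢 hconn T R ρ' hP d hker).1 (D.hKst_and_hLst_of_ker_piLevelAut_eq_charOpenCore h𝒢 hconn T R ρ' hP d hker).2 hKopen noSwitchBase hnobpNCpt stabBranchPairAug hest hbot,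
    arithMaximalCompactStatementII_outerAction_piPresentation_chart D h𝒢 hcof hcn hS hfin hne hconn h37 hG ρ' baseAct T R Rc hP w₀
      (D.hKst_and_hLst_of_ker_piLevelAut_eq_charOpenCore h𝒢 hconn T R ρ' hP d hker).1 (D.hKst_and_hLst_of_ker_piLevelAut_eq_charOpenCore h𝒢 hconn T R ρ' hP d hker).2 hKopen noSwitchBase hnobpNCpt stabBranchPairAug hest hbot hR hVE⟩

end ProfiniteSemiGraph

end Literature.AnabelianGeometry.SemiGraphs
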